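import Summits.NavierStokesRegularity.NavierStokesRegularity.Theorems.ExtremiserTransienceTwoThirdsBallCalculus
import Literature.Analysis.FluidPDE.NSVorticityBKMProofs
import HarnessLib

/-!
# Route `ExtremiserTransience`, crux `NearExtremalTransiencePerFlow` (stmt-NavierStokesRegularity-26567),
# LINE g10-1 «two_thirds» (ns-idea-10), stub S1a′ — BRICK 3b, lemma (i): THICK CELLS ARE FEW

`--supports stmt-NavierStokesRegularity-26567` (helper; prover seat ns-net-p2 g12; design = evidence #59 on ⟨26567⟩).  Normalised units
(`IsReg A w 1`, `lam w = 1`).  A cell `B(c, s)` of a packing (centres `4s`-separated, `s ≥ 1`) whose INNER ball `B(c, s/2)` contains a THICK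
point (`‖curl w‖ ≥ θ₀`) carries enstrophy `≥ c_th = (θ₀/2)²·vol B(0, ρ₀)`, `ρ₀ = min(θ₀/(8A₂), 1/2)` (the vorticity is `4A₂`-Lipschitz:
`‖D curl w‖ ≤ 4‖D²w‖ ≤ 4A₂`); the cells of one packing are disjoint, so

* `card_thickCells_mul_le` — `#F · c_th ≤ Z` for every finite `4s`-separated family `F` of centres with thick inner balls.

This bounds the number of pieces that pay GAUGE JUNK in brick 2 (the per-piece junk `g_r` is absolute, so `#F ≤ Z/c_th` makes `Σ g_r = o(1)·Z`).
HONEST FRAMING: bookkeeping over one vector field; nothing about Navier–Stokes is proved; no summit is proved by a line. [folklore]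
-/

noncomputable section

open scoped Topology InnerProductSpace RealInnerProductSpace ENNReal NNReal ContDiff
open MeasureTheory Filter Set Metric Function
open Literature.Analysis Literature.Analysis.FluidPDE
open Summit.NavierStokesRegularity.NavierStokesRegularity.Theorems.DepletionLadder.KStar.HalfSpace
open Summit.NavierStokesRegularity.NavierStokesRegularity.Theorems.DepletionLadder.KStar.BangBang
open Summit.NavierStokesRegularity.NavierStokesRegularity.Theorems.NearExtremalTransiencePerFlow.LocalMaximiser

namespace Summit.NavierStokesRegularity.NavierStokesRegularity.Theorems.NearExtremalTransiencePerFlow.TwoThirds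

-- the problem directory repeats the summit name (`NavierStokesRegularity/NavierStokesRegularity`)
set_option linter.dupNamespace false
set_option linter.style.longLine false

/-- **Vorticity is `4A₂`-Lipschitz in the normalised regular class** (`IsReg A w 1`, `lam w = 1`). -/
theorem norm_curl_sub_le_of_isReg {A : ℕ → ℝ} {w : E3 → E3} (hw : ContDiff ℝ (⊤ : ℕ∞) w) (hreg : IsReg A w 1)
    (hlam : lam w = 1) (x y : E3) : ‖curl w y - curl w x‖ ≤ 4 * A 2 * ‖y - x‖ := by
  have hcd : ContDiff ℝ 1 (curl w) := contDiff_curl (n := 1) (hw.of_le (by norm_cast))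
  have hdiff : ∀ z ∈ (Set.univ : Set E3), DifferentiableAt ℝ (curl w) z := fun z _ => (hcd.differentiable (by simp)) z
  have hbound : ∀ z ∈ (Set.univ : Set E3), ‖fderiv ℝ (curl w) z‖ ≤ 4 * A 2 := by
    intro z _
    rw [← norm_iteratedFDeriv_one (𝕜 := ℝ)]
    refine (norm_iteratedFDeriv_curl_le_four_mul hw 1 z).trans ?_
    have h := hreg 2 z
    rw [hlam, inv_one, one_pow, mul_one, mul_one] at h
    linarith
  exact convex_univ.norm_image_sub_le_of_norm_fderiv_le hdiff hbound (Set.mem_univ x) (Set.mem_univ y)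

/-- **A thick point carries enstrophy `≥ c_th` on the ball of radius `ρ₀ = min(θ₀/(8A₂), 1/2)` around it.** -/
theorem enstrophy_ball_ge_of_thick {A : ℕ → ℝ} {w : E3 → E3} (hw : ContDiff ℝ (⊤ : ℕ∞) w) (hreg : IsReg A w 1) (hlam : lam w = 1)
    (hA2 : 1 ≤ A 2) {θ₀ : ℝ} (hθ₀ : 0 < θ₀) {x : E3} (hx : θ₀ ≤ ‖curl w x‖) :
    (θ₀ / 2) ^ 2 * (volume : Measure E3).real (Metric.ball x (min (θ₀ / (8 * A 2)) (1 / 2))) ≤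
      ∫ y in Metric.ball x (min (θ₀ / (8 * A 2)) (1 / 2)), ‖curl w y‖ ^ 2 := by
  set ρ₀ : ℝ := min (θ₀ / (8 * A 2)) (1 / 2) with hρ₀
  have hA2pos : 0 < A 2 := lt_of_lt_of_le one_pos hA2
  have hρ₀le : ρ₀ ≤ θ₀ / (8 * A 2) := min_le_left _ _
  have hcont : Continuous fun y => ‖curl w y‖ ^ 2 :=
    ((contDiff_curl (n := 1) (hw.of_le (by norm_cast))).continuous.norm).pow 2
  have hint : IntegrableOn (fun y => ‖curl w y‖ ^ 2) (Metric.ball x ρ₀) :=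
    (hcont.continuousOn.integrableOn_compact (isCompact_closedBall x ρ₀)).mono_set Metric.ball_subset_closedBall
  have hlow : ∀ y ∈ Metric.ball x ρ₀, (θ₀ / 2) ^ 2 ≤ ‖curl w y‖ ^ 2 := by
    intro y hy
    have hd : ‖y - x‖ < ρ₀ := by rw [← dist_eq_norm]; exact Metric.mem_ball.1 hy
    have hlip := norm_curl_sub_le_of_isReg hw hreg hlam x y
    have h1 : ‖curl w x‖ ≤ ‖curl w y‖ + ‖curl w y - curl w x‖ := by
      calc ‖curl w x‖ = ‖curl w y - (curl w y - curl w x)‖ := by rw [sub_sub_cancel]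
        _ ≤ ‖curl w y‖ + ‖curl w y - curl w x‖ := norm_sub_le _ _
    have h2 : 4 * A 2 * ‖y - x‖ ≤ 4 * A 2 * ρ₀ := mul_le_mul_of_nonneg_left hd.le (by positivity)
    have h3 : 4 * A 2 * ρ₀ ≤ θ₀ / 2 := by
      calc 4 * A 2 * ρ₀ ≤ 4 * A 2 * (θ₀ / (8 * A 2)) := mul_le_mul_of_nonneg_left hρ₀le (by positivity)
        _ = θ₀ / 2 := by field_simp; ring
    have h4 : θ₀ / 2 ≤ ‖curl w y‖ := by linarith
    exact pow_le_pow_left₀ (by positivity) h4 2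
  calc (θ₀ / 2) ^ 2 * (volume : Measure E3).real (Metric.ball x ρ₀)
      = ∫ _y in Metric.ball x ρ₀, (θ₀ / 2) ^ 2 := by rw [setIntegral_const, smul_eq_mul, mul_comm]
    _ ≤ ∫ y in Metric.ball x ρ₀, ‖curl w y‖ ^ 2 :=
        setIntegral_mono_on (integrableOn_const (C := (θ₀ / 2) ^ 2) measure_ball_lt_top.ne) hint measurableSet_ball hlow

/-- **Brick 3b (i) — thick cells are few.**  In the normalised regular class, every finite `4s`-separated family of centres (`s ≥ 1`) each of
whose inner balls `B(c, s/2)` contains a thick point (`‖curl w‖ ≥ θ₀`) satisfies `#F · c_th ≤ Z` with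
`c_th = (θ₀/2)²·vol B(0, min(θ₀/(8A₂), 1/2))`. [folklore] -/
theorem card_thickCells_mul_le {A : ℕ → ℝ} {w : E3 → E3} {B : ℝ} (hadm : IsAdm w 1 B) (hreg : IsReg A w 1) (hlam : lam w = 1)
    (hA2 : 1 ≤ A 2) {θ₀ s : ℝ} (hθ₀ : 0 < θ₀) (hs : 1 ≤ s) (F : Finset E3)
    (hsep : ∀ c ∈ F, ∀ c' ∈ F, c ≠ c' → 4 * s ≤ dist c c')
    (hthick : ∀ c ∈ F, ∃ x, dist x c < s / 2 ∧ θ₀ ≤ ‖curl w x‖) :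
    (F.card : ℝ) * ((θ₀ / 2) ^ 2 * (volume : Measure E3).real (Metric.ball (0 : E3) (min (θ₀ / (8 * A 2)) (1 / 2)))) ≤ Zen w := by
  classical
  obtain ⟨hv, -, -, -, -, h1, -⟩ := id hadm
  have hv2 : ContDiff ℝ 2 w := hv.of_le (by norm_cast)
  set ρ₀ : ℝ := min (θ₀ / (8 * A 2)) (1 / 2) with hρ₀
  have hρ₀half : ρ₀ ≤ 1 / 2 := min_le_right _ _
  have hρ₀pos : 0 < ρ₀ := lt_min (by have := lt_of_lt_of_le one_pos hA2; positivity) (by norm_num)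
  have hω2 : Integrable (fun y => ‖curl w y‖ ^ 2) := (integrable_norm_curl_sq hv2 h1).1
  -- each cell carries `≥ c_th`
  have hcell : ∀ c ∈ F, (θ₀ / 2) ^ 2 * (volume : Measure E3).real (Metric.ball (0 : E3) ρ₀) ≤ ∫ y in Metric.ball c s, ‖curl w y‖ ^ 2 := by
    intro c hc
    obtain ⟨x, hxc, hx⟩ := hthick c hc
    have hsub : Metric.ball x ρ₀ ⊆ Metric.ball c s := by
      intro y hy
      rw [Metric.mem_ball] at hy ⊢
      calc dist y c ≤ dist y x + dist x c := dist_triangle y x c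
        _ < ρ₀ + s / 2 := by linarith
        _ ≤ s := by linarith
    have hvol : (volume : Measure E3).real (Metric.ball (0 : E3) ρ₀) = (volume : Measure E3).real (Metric.ball x ρ₀) := by
      simp only [Measure.real, Measure.addHaar_ball_center]
    rw [hvol]
    refine (enstrophy_ball_ge_of_thick hv hreg hlam hA2 hθ₀ hx).trans ?_
    exact setIntegral_mono_set hω2.integrableOn (Eventually.of_forall fun y => sq_nonneg _) hsub.eventuallyLE
  -- the cells are disjoint, so their enstrophies add up to at most `Z`
  have hdisj : Set.Pairwise (↑F : Set E3) (Disjoint on fun c => Metric.ball c s) := by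
    intro c hc c' hc' hne
    exact Metric.ball_disjoint_ball (by linarith [hsep c hc c' hc' hne])
  have hsum : ∑ c ∈ F, ∫ y in Metric.ball c s, ‖curl w y‖ ^ 2 = ∫ y in ⋃ c ∈ F, Metric.ball c s, ‖curl w y‖ ^ 2 :=
    (integral_biUnion_finset F (fun c _ => measurableSet_ball) hdisj (fun c _ => hω2.integrableOn)).symm
  have htot : ∫ y in ⋃ c ∈ F, Metric.ball c s, ‖curl w y‖ ^ 2 ≤ Zen w := by
    unfold Zen; exact setIntegral_le_integral hω2 (Eventually.of_forall fun y => sq_nonneg _)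
  calc (F.card : ℝ) * ((θ₀ / 2) ^ 2 * (volume : Measure E3).real (Metric.ball (0 : E3) ρ₀))
      = ∑ _c ∈ F, (θ₀ / 2) ^ 2 * (volume : Measure E3).real (Metric.ball (0 : E3) ρ₀) := by
        rw [Finset.sum_const, nsmul_eq_mul]
    _ ≤ ∑ c ∈ F, ∫ y in Metric.ball c s, ‖curl w y‖ ^ 2 := Finset.sum_le_sum hcell
    _ ≤ Zen w := by rw [hsum]; exact htot

end Summit.NavierStokesRegularity.NavierStokesRegularity.Theorems.NearExtremalTransiencePerFlow.TwoThirds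

end
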